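import Summits.Ventures.PercRepro.NullityCircuitsB

/-!
# PercRepro — sets of rank `≤ 3` split along the union of the small circuits (night-1, gen 1; dossier §13.5)

Let `S₀ = ⋃ circuitsLE M 4` be the union of all circuits with at most `4` elements. A set `S` of rank `≤ 3` contains
only circuits with `≤ 4` elements (a circuit inside `S` has `r + 1 ≤ 4` elements), so every element of `S ∖ S₀` is a
coloop of `M|S` and the rank of `S` is the rank of `S ∩ S₀` plus the number of elements outside `S₀`:

* `notMem_closure_sdiff_of_notMem_sUnion` — `x ∈ S ∖ S₀`, `r(S) ≤ 3` ⇒ `x ∉ cl(S ∖ {x})`;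
* **`eRk_eq_eRk_inter_add_encard_sdiff`** — `r(S) = r(S ∩ S₀) + |S ∖ S₀|` for `S ⊆ E`, `r(S) ≤ 3`;
* `encard_sdiff_le_one_of_eRk_le_three` — hence `|S ∖ S₀| ≤ 1` as soon as `S ∩ S₀` has two elements and `M` is simple
  (the form used by the regime-C count: a dense set is a subset of `S₀` plus at most one outside point).
Axioms: standard.
-/

namespace PercRepro

namespace Matroid

open Set

variable {α : Type*} {M : _root_.Matroid α}

/-- In a set `S` of rank `≤ 3`, an element `x` lying in no circuit with `≤ 4` elements is a coloop of `M|S`: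
`x ∉ cl(S ∖ {x})` (a circuit through `x` inside `S` would have `r + 1 ≤ 4` elements). -/
theorem notMem_closure_sdiff_of_notMem_sUnion {S : Set α} (hr : M.eRk S ≤ 3)
    {x : α} (hx : x ∈ S) (hx0 : x ∉ ⋃₀ circuitsLE M 4) : x ∉ M.closure (S \ {x}) := by
  intro hxcl
  have hxS : x ∉ S \ {x} := fun h => h.2 rfl
  obtain ⟨C, hCsub, hC, hxC⟩ := _root_.Matroid.exists_isCircuit_of_mem_closure hxcl hxS
  have hCS : C ⊆ S := by
    refine hCsub.trans ?_
    rw [Set.insert_sdiff_singleton, Set.insert_eq_of_mem hx]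
  apply hx0
  refine Set.mem_sUnion.2 ⟨C, ⟨hC, ?_⟩, hxC⟩
  have h1 := hC.eRk_add_one_eq
  have h2 : M.eRk C ≤ 3 := (M.eRk_mono hCS).trans hr
  rw [← h1]
  calc M.eRk C + 1 ≤ 3 + 1 := by gcongr
    _ = ((4 : ℕ) : ℕ∞) := by norm_num

/-- **Lemma 13.5**: for `S ⊆ E` of rank `≤ 3` and `S₀ = ⋃ circuitsLE M 4`, `r(S) = r(S ∩ S₀) + |S ∖ S₀|`. -/
theorem eRk_eq_eRk_inter_add_encard_sdiff [M.Finite] {S : Set α} (hS : S ⊆ M.E) (hr : M.eRk S ≤ 3) :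
    M.eRk S = M.eRk (S ∩ ⋃₀ circuitsLE M 4) + (S \ ⋃₀ circuitsLE M 4).encard := by
  classical
  have hfin : (S \ ⋃₀ circuitsLE M 4).Finite := (M.ground_finite.subset hS).sdiff
  generalize hn : (S \ ⋃₀ circuitsLE M 4).ncard = n
  induction n generalizing S with
  | zero =>
    have hempty : S \ ⋃₀ circuitsLE M 4 = ∅ := (Set.ncard_eq_zero hfin).1 hn
    rw [hempty, Set.encard_empty, add_zero, Set.inter_eq_left.2 (Set.sdiff_eq_empty.1 hempty)]
  | succ n ih =>
    obtain ⟨x, hx⟩ : (S \ ⋃₀ circuitsLE M 4).Nonempty := by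
      rw [Set.nonempty_iff_ne_empty]
      intro h
      rw [h, Set.ncard_empty] at hn
      omega
    have hxS : x ∈ S := hx.1
    have hxS₀ : x ∉ ⋃₀ circuitsLE M 4 := hx.2
    have hS'E : S \ {x} ⊆ M.E := Set.sdiff_subset.trans hS
    have hS'r : M.eRk (S \ {x}) ≤ 3 := (M.eRk_mono Set.sdiff_subset).trans hr
    have hcomm : (S \ {x}) \ ⋃₀ circuitsLE M 4 = (S \ ⋃₀ circuitsLE M 4) \ {x} := Set.sdiff_sdiff_comm
    have hS'fin : ((S \ {x}) \ ⋃₀ circuitsLE M 4).Finite := by rw [hcomm]; exact hfin.sdiff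
    have hS'n : ((S \ {x}) \ ⋃₀ circuitsLE M 4).ncard = n := by
      rw [hcomm, Set.ncard_sdiff_singleton_of_mem hx, hn]
      rfl
    have hIH := ih hS'E hS'r hS'fin hS'n
    have hinter : (S \ {x}) ∩ ⋃₀ circuitsLE M 4 = S ∩ ⋃₀ circuitsLE M 4 := by
      ext y
      simp only [Set.mem_inter_iff, Set.mem_sdiff, Set.mem_singleton_iff]
      constructor
      · rintro ⟨⟨hy, _⟩, hy0⟩
        exact ⟨hy, hy0⟩
      · rintro ⟨hy, hy0⟩
        exact ⟨⟨hy, fun h => hxS₀ (h ▸ hy0)⟩, hy0⟩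
    have hx_notcl : x ∉ M.closure (S \ {x}) := notMem_closure_sdiff_of_notMem_sUnion hr hxS hxS₀
    have hins : S = insert x (S \ {x}) := by rw [Set.insert_sdiff_singleton, Set.insert_eq_of_mem hxS]
    have hrS : M.eRk S = M.eRk (S \ {x}) + 1 := by
      conv_lhs => rw [hins]
      exact _root_.Matroid.eRk_insert_eq_add_one ⟨hS hxS, hx_notcl⟩
    have hcard : (S \ ⋃₀ circuitsLE M 4).encard = ((S \ {x}) \ ⋃₀ circuitsLE M 4).encard + 1 := by
      rw [hcomm, Set.encard_sdiff_singleton_add_one hx]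
    rw [hrS, hIH, hinter, hcard]
    ring

/-- **At most one point outside `S₀`**: if `M` is simple, `S ⊆ E` has rank `≤ 3` and `S ∩ S₀` contains two distinct
elements, then `|S ∖ S₀| ≤ 1` — a dense set is a subset of the small-circuit union plus at most one further point. -/
theorem encard_sdiff_le_one_of_eRk_le_three [M.Finite]
    (hs : ∀ e ∈ M.E, ∀ f ∈ M.E, e ≠ f → M.eRk {e, f} = 2)
    {S : Set α} (hS : S ⊆ M.E) (hr : M.eRk S ≤ 3) {a b : α} (hab : a ≠ b)
    (ha : a ∈ S ∩ ⋃₀ circuitsLE M 4) (hb : b ∈ S ∩ ⋃₀ circuitsLE M 4) :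
    (S \ ⋃₀ circuitsLE M 4).encard ≤ 1 := by
  have h := eRk_eq_eRk_inter_add_encard_sdiff hS hr
  have h2 : 2 ≤ M.eRk (S ∩ ⋃₀ circuitsLE M 4) := by
    have hpair : ({a, b} : Set α) ⊆ S ∩ ⋃₀ circuitsLE M 4 := by
      intro z hz
      rcases hz with rfl | rfl
      · exact ha
      · exact hb
    rw [← hs a (hS ha.1) b (hS hb.1) hab]
    exact M.eRk_mono hpair
  have hfin : (S \ ⋃₀ circuitsLE M 4).Finite := (M.ground_finite.subset hS).sdiff
  have hfin' : (S \ ⋃₀ circuitsLE M 4).encard ≠ ⊤ := hfin.encard_lt_top.ne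
  obtain ⟨k, hk⟩ := ENat.ne_top_iff_exists.1 hfin'
  have hr' : M.eRk (S ∩ ⋃₀ circuitsLE M 4) ≠ ⊤ :=
    ((M.eRk_le_encard _).trans_lt ((M.ground_finite.subset hS).inter_of_left _).encard_lt_top).ne
  obtain ⟨m, hm⟩ := ENat.ne_top_iff_exists.1 hr'
  rw [← hk, ← hm] at h
  rw [← hm] at h2
  rw [← hk]
  have h3 : (m : ℕ∞) + k ≤ 3 := by rw [← h]; exact hr
  have h3' : m + k ≤ 3 := by exact_mod_cast h3
  have h2' : 2 ≤ m := by exact_mod_cast h2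
  have hk1 : k ≤ 1 := by omega
  exact_mod_cast hk1

end Matroid

end PercRepro
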